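import Summits.QuantumFields.BalabanUV.Beta.D1BFx.ProjectorMasses

/-!
# `BalabanUV.Beta.D1BFx.ProjectorGradientMass` — road «BF-x» for BINDER row D1, slot (K), binder (C1) «TB4-W CO-FRAME FIRST JET,
# m-UNIFORM MASS»: THE LAST LETTER — the column masses of the row-gradients of the projector `Pgt n a` from those of the ghost leg
# (part 4 of «COFRAME-JET-DIPOLE»; on gan24-leaf-05's γ2 `ProjectorMasses` BY NAME)

HONEST DEPENDENCY (page 1, mandatory): continuum YM on T⁴ ⇐ BetaPertH ∧ nine spine estimates (0/9 proved); BetaPertH ⇐ (D1) ∧ (D4) ∧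
CAP+tail; G-an2-4 gates asym, D1 and NE2/3/4.  HONEST FRAMING (cell contract, verbatim): «discharging `BetaPertH` makes Bałaban's UV
stability UNCONDITIONAL — a real constructive-QFT result; it is NOT the continuum limit and NOT the Clay problem.»  THIS FILE DISCHARGES
NOTHING of D1 / BetaPertH: [folklore] `ℓ¹` bookkeeping in gan24-leaf-05's currency (`KernelMassCalculus.ColMass`) over the road's OWN
objects (`ProjectorMasses.gqK ∕ csqK`, `Pgt_eq_comp : Pgt = n⁻⁴•((gqK∘csqK)∘gqKᵀ)`).  It proves NO estimate of Bałaban's: the analytic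
input is the column mass of the ROW-GRADIENTS of `Ggh` (gan24-leaf-05 β2 `GhostLegProfile.exists_Ggh_masses`: `g₁∕n` on `n = L^k`, IN
THE TREE), which this file only PROPAGATES through the block sum `gqK` (`n⁴·e^{4nθ}`), the operator `csqK` (`c_C·Zl`) and `gqKᵀ`
(`e^{4nθ}·g`) exactly as γ2's `masses_Pgt` propagates the mass itself.  0∕4 row-D1 binders discharged; (K) NOT closed; NOT D1,
NOT BetaPertH, NOT continuum, NOT Clay.

WHAT IS HERE (unit `b2b-balaban-beta-d1-formalise-leaf-03`, gen 25, INTENT-1 «COFRAME-JET-DIPOLE» part 4; `∇_α K := (x,y) ↦ K(x+e_α,y) − K(x,y)`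
INLINE, no def):
* §1 `rowGrad_smul`, `rowGrad_comp_of_masses` (`∇_α(A∘B) = (∇_αA)∘B` when `A` has a row mass and `B` a column mass, `θ ≥ 0` — the
  slices converge absolutely; no `Tame` needed).
* §2 **`colMass_rowGrad_gqK (hθ : 0 ≤ θ) (hG₁ : ColMass (∇_α (Ggh n a)) θ g₁) : ColMass (∇_α (gqK n a)) θ (n⁴·e^{4nθ}·g₁)`** — γ2's
  `colMass_gqK` with the leg replaced by its row-gradient (one column of `gqK` = a block of `n⁴` columns of `Ggh`).
* §3 **`colMass_rowGrad_Pgt (ha) (hθ : 0 ≤ θ) (hθC : n·θ < δ_C∕4) (hG : RowMass (Ggh n a) θ g) (hGc : ColMass (Ggh n a) θ g)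
  (hG₁ : ColMass (∇_α (Ggh n a)) θ g₁) : ColMass (∇_α (Pgt n a)) θ (e^{8nθ}·g₁·g·(c_C·Zl 4 (δ_C∕4 − nθ)))`** — THE LETTER `p₁` of part 3's
  `CoframeJetDipoleLetters.tBw₁_weighted_mass_le_of_leg_letters`.  LOCATED COUNT (not a theorem here): with β2's `g₁ ↦ g₁∕n` at
  `θ = σV∕n ≤ δ∕(8n)`, `nθ = σV < δ_C∕4`: `p₁ = O(1∕n)` — the (C1) row on `n = L^k` is then a composition of theorems in the tree plus
  the k-bookkeeping of the façade (leaf-01 g24 cert J62-C1).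

No `def`, no `def … : Prop`, nothing cited as mathematics.
-/

noncomputable section

namespace Summit.QuantumFields.BalabanUV.Beta.D1BFx.ProjectorGradientMass

open scoped BigOperators
open Finset
open Literature.MathematicalPhysics.QuantumFieldTheory.Balaban1983to89
open Literature.MathematicalPhysics.QuantumFieldTheory.Balaban1983to89.Beta
open B12Sec2to5 (l1 l1_nonneg)
open ExpKernelCalculus (Site MKer comp Zl Zl_pos l1_sub_triangle)
open AffineAveraging (unitVec)
open B6QGQLower276 (B mem_B)
open B5Hk103ScalarZd (Gk gq)
open B6QGGQ278Zd (cC deltaC cC_pos)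
open Summit.QuantumFields.BalabanUV.Beta.TameKernelCalculus (trK trK_trK)
open Summit.QuantumFields.BalabanUV.Beta.D1BFx.GhostLeg (Ggh Ggh_apply cast_pred_add_one)
open Summit.QuantumFields.BalabanUV.Beta.D1BFx.RProjector (Pgt)
open Summit.QuantumFields.BalabanUV.Beta.D1BFx.KernelMassCalculus
open Summit.QuantumFields.BalabanUV.Beta.D1BFx.ProjectorMasses (gqK csqK smul_facts eq_smul_of_dvd l1_sub_smul_blk_le Pgt_eq_comp
  rowMass_gqK masses_csqK)

/-! ## §1 Row-gradients: scalars and compositions under masses -/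

/-- [folklore] `∇_α (c • K) = c • ∇_α K` (pointwise). -/
theorem rowGrad_smul (c : ℝ) (K : MKer 4 Unit) (α : Fin 4) :
    (fun x y (v w : Unit) => (c • K) (x + unitVec α) y v w - (c • K) x y v w)
      = c • (fun x y (v w : Unit) => K (x + unitVec α) y v w - K x y v w) := by
  funext x y v w
  simp only [Pi.smul_apply, smul_eq_mul]
  ring

variable {θ : ℝ}

/-- [folklore] The slices of `A ∘ B` converge absolutely when `A` has a `θ`-row mass and `B` a `θ`-column mass (`θ ≥ 0`). -/
theorem summable_slice_of_masses {A B : MKer 4 Unit} {MA MB : ℝ} (hθ : 0 ≤ θ) (hA : RowMass A θ MA) (hB : ColMass B θ MB)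
    (x z : Site 4) (v w : Unit) : Summable fun y => ∑ f : Unit, A x y v f * B y z f w := by
  refine summable_sum fun f _ => ?_
  have hsA : Summable fun y => |A x y v f| :=
    (hA x).1.of_nonneg_of_le (fun y => abs_nonneg _) fun y => (abs_le_rowFn_zero A x y v f).trans (rowFn_zero_le A hθ x y)
  refine Summable.of_norm ((hsA.mul_right MB).of_nonneg_of_le (fun y => norm_nonneg _) fun y => ?_)
  rw [Real.norm_eq_abs, abs_mul]
  exact mul_le_mul_of_nonneg_left (hB.abs_le hθ y z f w) (abs_nonneg _)

/-- [folklore] **`∇_α (A ∘ B) = (∇_α A) ∘ B`** under a row mass of `A` and a column mass of `B`. -/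
theorem rowGrad_comp_of_masses {A B : MKer 4 Unit} {MA MB : ℝ} (hθ : 0 ≤ θ) (hA : RowMass A θ MA) (hB : ColMass B θ MB) (α : Fin 4) :
    (fun x z (v w : Unit) => comp A B (x + unitVec α) z v w - comp A B x z v w)
      = comp (fun x y (v w : Unit) => A (x + unitVec α) y v w - A x y v w) B := by
  funext x z v w
  show (∑' y, ∑ f, A (x + unitVec α) y v f * B y z f w) - (∑' y, ∑ f, A x y v f * B y z f w)
    = ∑' y, ∑ f, (A (x + unitVec α) y v f - A x y v f) * B y z f w
  rw [← (summable_slice_of_masses hθ hA hB (x + unitVec α) z v w).tsum_sub (summable_slice_of_masses hθ hA hB x z v w)]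
  refine tsum_congr fun y => ?_
  rw [← Finset.sum_sub_distrib]
  refine Finset.sum_congr rfl fun f _ => ?_
  ring

/-! ## §2 The row-gradient of `gqK`: a block of `n⁴` row-gradients of `Ggh` -/

section Legs

variable (n : ℕ) [NeZero n] (a : ℝ)

/-- [folklore] **COLUMN MASS OF `∇_α gqK`**: `ColMass (∇_α Ggh) θ g₁ → ColMass (∇_α gqK) θ (n⁴·e^{4nθ}·g₁)` (`θ ≥ 0`) — γ2's `colMass_gqK`
with the leg replaced by its row-gradient, same block-by-block count. -/
theorem colMass_rowGrad_gqK (hθ : 0 ≤ θ) {g₁ : ℝ} (α : Fin 4)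
    (hG₁ : ColMass (fun x y (v w : Unit) => Ggh n a (x + unitVec α) y v w - Ggh n a x y v w) θ g₁) :
    ColMass (fun x y (v w : Unit) => gqK n a (x + unitVec α) y v w - gqK n a x y v w) θ ((n : ℝ) ^ 4 * Real.exp (4 * n * θ) * g₁) := by
  obtain ⟨hinj, hdvd, hdiv⟩ := smul_facts (n := n)
  have hg0 : 0 ≤ g₁ := hG₁.nonneg
  intro u'
  by_cases hu' : ∀ i, (n : ℤ) ∣ u' i
  · set w : Site 4 := fun i => u' i / (n : ℤ) with hw
    have hu'eq : u' = (n : ℤ) • w := eq_smul_of_dvd hu'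
    have ecol : ∀ x, rowFn (fun x y (v w : Unit) => gqK n a (x + unitVec α) y v w - gqK n a x y v w) θ x u'
        = |∑ q ∈ B (n - 1) w, (Gk (d := 4) (n - 1) a (x + unitVec α) q - Gk (d := 4) (n - 1) a x q)| * Real.exp (θ * l1 (x - u')) := by
      intro x
      have e1 : ∀ x' : Site 4, gqK n a x' u' () () = ∑ q ∈ B (n - 1) w, Gk (d := 4) (n - 1) a x' q := fun x' => by
        simp only [gqK, hu', forall_const, if_true]; rfl
      unfold rowFn
      simp only [Finset.univ_unique, PUnit.default_eq_unit, Finset.sum_singleton]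
      rw [e1, e1, ← Finset.sum_sub_distrib]
    have egrad : ∀ x q, rowFn (fun x y (v w : Unit) => Ggh n a (x + unitVec α) y v w - Ggh n a x y v w) θ x q
        = |Gk (d := 4) (n - 1) a (x + unitVec α) q - Gk (d := 4) (n - 1) a x q| * Real.exp (θ * l1 (x - q)) := by
      intro x q
      unfold rowFn
      simp only [Finset.univ_unique, PUnit.default_eq_unit, Finset.sum_singleton, Ggh_apply]
    have hle : ∀ x, rowFn (fun x y (v w : Unit) => gqK n a (x + unitVec α) y v w - gqK n a x y v w) θ x u'
        ≤ Real.exp (4 * n * θ) * ∑ q ∈ B (n - 1) w,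
            rowFn (fun x y (v w : Unit) => Ggh n a (x + unitVec α) y v w - Ggh n a x y v w) θ x q := by
      intro x
      rw [ecol]
      refine (mul_le_mul_of_nonneg_right (Finset.abs_sum_le_sum_abs _ _) (Real.exp_pos _).le).trans ?_
      rw [Finset.mul_sum, Finset.sum_mul]
      refine Finset.sum_le_sum fun q hq => ?_
      rw [egrad]
      have hl : l1 (x - u') ≤ l1 (x - q) + 4 * n := by
        have := l1_sub_triangle x q u'
        have h2 := l1_sub_smul_blk_le (n := n) (mem_B.1 hq)
        rw [← hu'eq] at h2
        linarith
      calc |Gk (d := 4) (n - 1) a (x + unitVec α) q - Gk (d := 4) (n - 1) a x q| * Real.exp (θ * l1 (x - u'))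
          ≤ |Gk (d := 4) (n - 1) a (x + unitVec α) q - Gk (d := 4) (n - 1) a x q| * Real.exp (θ * (l1 (x - q) + 4 * n)) :=
            mul_le_mul_of_nonneg_left (Real.exp_le_exp.2 (mul_le_mul_of_nonneg_left hl hθ)) (abs_nonneg _)
        _ = Real.exp (4 * n * θ) * (|Gk (d := 4) (n - 1) a (x + unitVec α) q - Gk (d := 4) (n - 1) a x q|
              * Real.exp (θ * l1 (x - q))) := by
            rw [mul_add, Real.exp_add]; ring
    have hsB : Summable fun x => Real.exp (4 * n * θ) * ∑ q ∈ B (n - 1) w,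
        rowFn (fun x y (v w : Unit) => Ggh n a (x + unitVec α) y v w - Ggh n a x y v w) θ x q :=
      (summable_sum fun q _ => (hG₁ q).1).mul_left _
    have hs : Summable fun x => rowFn (fun x y (v w : Unit) => gqK n a (x + unitVec α) y v w - gqK n a x y v w) θ x u' :=
      hsB.of_nonneg_of_le (fun x => rowFn_nonneg _ _ _ _) hle
    refine ⟨hs, (hs.tsum_le_tsum hle hsB).trans ?_⟩
    rw [tsum_mul_left, Summable.tsum_finsetSum (fun q _ => (hG₁ q).1)]
    have hB : ∑ q ∈ B (n - 1) w, ∑' x, rowFn (fun x y (v w : Unit) => Ggh n a (x + unitVec α) y v w - Ggh n a x y v w) θ x q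
        ≤ (n : ℝ) ^ 4 * g₁ :=
      calc ∑ q ∈ B (n - 1) w, ∑' x, rowFn (fun x y (v w : Unit) => Ggh n a (x + unitVec α) y v w - Ggh n a x y v w) θ x q
          ≤ ∑ _q ∈ B (n - 1) w, g₁ := Finset.sum_le_sum fun q _ => (hG₁ q).2
        _ = (n : ℝ) ^ 4 * g₁ := by rw [B6QGQLower276.sum_B_const, cast_pred_add_one n]
    calc Real.exp (4 * n * θ) * ∑ q ∈ B (n - 1) w, ∑' x,
          rowFn (fun x y (v w : Unit) => Ggh n a (x + unitVec α) y v w - Ggh n a x y v w) θ x q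
        ≤ Real.exp (4 * n * θ) * ((n : ℝ) ^ 4 * g₁) := mul_le_mul_of_nonneg_left hB (Real.exp_pos _).le
      _ = (n : ℝ) ^ 4 * Real.exp (4 * n * θ) * g₁ := by ring
  · have hz : ∀ x, rowFn (fun x y (v w : Unit) => gqK n a (x + unitVec α) y v w - gqK n a x y v w) θ x u' = 0 := fun x => by
      unfold rowFn
      simp [gqK, hu']
    refine ⟨(summable_zero).congr fun x => (hz x).symm, ?_⟩
    simp_rw [hz]
    rw [tsum_zero]
    positivity

/-! ## §3 The letter `p₁`: the column masses of the row-gradients of the projector -/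

/-- [folklore] **THE PROJECTOR's GRADIENT LETTER**: for `θ ≥ 0`, `nθ < δ_C∕4`, from the masses `g` of `Ggh n a` and the column mass `g₁`
of its row-gradient along `e_α`:
`ColMass (∇_α (Pgt n a)) θ (e^{8nθ}·g₁·g·(c_C·Zl 4 (δ_C∕4 − nθ)))` — `∇_α P = n⁻⁴•((∇_α gqK ∘ csqK) ∘ gqKᵀ)` and γ2's factor masses. -/
theorem colMass_rowGrad_Pgt (ha : 0 < a) (hθ : 0 ≤ θ) (hθC : (n : ℝ) * θ < deltaC 4 a / 4) {g g₁ : ℝ} (α : Fin 4)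
    (hG : RowMass (Ggh n a) θ g) (hGc : ColMass (Ggh n a) θ g)
    (hG₁ : ColMass (fun x y (v w : Unit) => Ggh n a (x + unitVec α) y v w - Ggh n a x y v w) θ g₁) :
    ColMass (fun x y (v w : Unit) => Pgt n a (x + unitVec α) y v w - Pgt n a x y v w) θ
      (Real.exp (8 * n * θ) * g₁ * g * (cC 4 a * Zl 4 (deltaC 4 a / 4 - n * θ))) := by
  have hn : (0 : ℝ) < n := Nat.cast_pos.2 (Nat.pos_of_ne_zero (NeZero.ne n))
  obtain ⟨hCr, hCc⟩ := masses_csqK (n := n) (a := a) ha hθC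
  have hQr := rowMass_gqK (n := n) (a := a) hθ hG
  have hQc := ProjectorMasses.colMass_gqK (n := n) (a := a) hθ hGc
  have hQ1 := colMass_rowGrad_gqK n a hθ α hG₁
  -- the transposed factor: `ColMass (trK gqK) = RowMass gqK`
  have hT : ColMass (trK (gqK n a)) θ (Real.exp (4 * n * θ) * g) := by
    rw [colMass_iff_rowMass_trK, trK_trK]; exact hQr
  -- row mass of the inner composition `gqK ∘ csqK` (for the slice summability of the outer gradient)
  have hIr : RowMass (comp (gqK n a) (csqK n a)) θ ((Real.exp (4 * n * θ) * g) * (cC 4 a * Zl 4 (deltaC 4 a / 4 - n * θ))) :=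
    rowMass_comp hQr hCr hθ
  -- the gradient passes to the first factor twice
  rw [Pgt_eq_comp (n := n) (a := a) ha, rowGrad_smul, rowGrad_comp_of_masses hθ hIr hT, rowGrad_comp_of_masses hθ hQr hCc]
  have h := ((colMass_comp (colMass_comp hQ1 hCc hθ) hT hθ).smul (((n : ℝ) ^ 4)⁻¹))
  refine h.mono le_rfl (le_of_eq ?_)
  rw [abs_of_pos (by positivity), show (8 : ℝ) * n * θ = 4 * n * θ + 4 * n * θ by ring, Real.exp_add]
  field_simp

end Legs

end Summit.QuantumFields.BalabanUV.Beta.D1BFx.ProjectorGradientMass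

end
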